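import Summits.QuantumFields.QCD.Theorems.QuarksAsStableActionWilsonQuarkStabilityStubReflectionStep
import Summits.QuantumFields.QCD.Theorems.QuarksAsStableActionWilsonQuarkStabilityStubChessboardOfReflection
import Summits.QuantumFields.QCD.Theorems.QuarksAsStableActionWilsonQuarkStabilityStubCyclicHolder

/-!
# The even-cycle chessboard estimate: generalised Hölder inequality for Schatten norms, `2n` equal exponents
(helper stub `evenCycleChessboard` — Route B, step B4, of `stub_heavyFrequencyGain`; line `Sketch`,
crux `QuarksAsStableAction.CriticalLineDiamagnetism`, item stmt-QuantumFields-9734;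
lead prover-line-stmt-QuantumFields-9734-c3-0)

For arbitrary complex square matrices `B_0, …, B_{2n-1}` (`n ≥ 1`):
`‖Tr (B_0 B_1 ⋯ B_{2n-1})‖^{2n} ≤ ∏_j Re Tr ((B_j B_jᴴ)^n)` (`= ∏_j ‖B_j‖_{S_{2n}}^{2n}`).
Proof (Fröhlich–Israel–Lieb–Simon maximiser argument over words in the letters `B_j, B_jᴴ`): letters
`γ = ZMod (2n) × Bool` (index, adjoint flag) with the involution `φ (j, b) = (j, ¬b)`; for a word `w : ZMod (2n) → γ`,
`F(w) := ‖Tr ∏_{i<2n} L(w i)‖` (`L(j, ff) = B_j`, `L(j, tt) = B_jᴴ`).  Hilbert–Schmidt Cauchy–Schwarz with `P` = first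
`n` letters, `Q` = last `n` letters gives the reflection step `F(w)² ≤ F(w⁺) F(w⁻)`,
`w⁺ = (w_0,…,w_{n-1}, φ w_{n-1},…,φ w_0)`, `w⁻ = (φ w_{2n-1},…,φ w_n, w_n,…,w_{2n-1})`; the trace is rotation
invariant.  For `Φ(w) := F(w)^{2n} / ∏_i ν(w i)`, `ν(j, b) := Re Tr ((B_j B_jᴴ)^n) > 0`, the two reflected words
use every position of `w` exactly twice, so a maximiser of `Φ` stays a maximiser under `w ↦ w⁺` and under
rotations; reflecting just after an ALTERNATING block `(a, φ a, a, …)` (parity pattern read off the absolute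
position) doubles it, so `O(log n)` steps give an alternating maximiser, where `F = Tr ((L_a L_aᴴ)^n) = ν(a)`,
`Φ = 1`.  Degenerate letters: if some `B_j = 0` the left-hand side vanishes, otherwise every `ν > 0`.
References: J. Fröhlich, R. Israel, E. H. Lieb, B. Simon, Commun. Math. Phys. 62 (1978) 1, Thm. 4.1; B. Simon,
*Trace ideals and their applications*, Thm. 2.8.  The odd-cycle analogue (static extremal words) is `stub_cyclicHolder`
(`stub_chessboardOfReflection`, `stub_reflectionStep`) of the sibling crux 9736, whose bookkeeping lemmas are reused.
Pure theorem file (no definitions).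
-/

namespace Summit.QuantumFields.QCD.Cruxes.CriticalLineDiamagnetism.ChessboardCellGain

namespace EvenCycleChessboard

open Finset
open Summit.QuantumFields.QCD.Cruxes.WilsonQuarkStability.FreeTangentLandauChessboard
open Summit.QuantumFields.QCD.Cruxes.WilsonQuarkStability.FreeTangentLandauChessboard.ChessboardOfReflection
open Summit.QuantumFields.QCD.Cruxes.WilsonQuarkStability.FreeTangentLandauChessboard.CyclicHolder

variable {γ : Type}

/-- Shifting an alternating pattern `(a, φ a, a, …)` (read off the parity of the absolute position `q`) by `s`
positions gives the alternating pattern of `a` or of `φ a`. -/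
theorem alt_shift (φ : γ → γ) (hφ : ∀ a, φ (φ a) = a) (a : γ) (q s : ℕ) :
    (if q % 2 = 0 then (if s % 2 = 0 then a else φ a) else φ (if s % 2 = 0 then a else φ a)) =
      if (q + s) % 2 = 0 then a else φ a := by
  split_ifs <;> first | rfl | exact hφ a | exact (hφ a).symm | omega

/-- Shifting a word with an alternating block at `0 ≤ q < K` by `-t`: an alternating block at `t ≤ q < t + K`. -/
theorem block_shift_to_end (n : ℕ) (φ : γ → γ) (hφ : ∀ a, φ (φ a) = a) (w : ZMod (2 * n) → γ) (a : γ)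
    (K t : ℕ) (hw : ∀ q : ℕ, q < K → w q = if q % 2 = 0 then a else φ a) :
    ∀ q : ℕ, t ≤ q → q < t + K →
      (fun j : ZMod (2 * n) => w (j + -((t : ℕ) : ZMod (2 * n)))) q =
        if q % 2 = 0 then (if t % 2 = 0 then a else φ a) else φ (if t % 2 = 0 then a else φ a) := by
  intro q h1 h2
  show w (q + -((t : ℕ) : ZMod (2 * n))) = _
  rw [← sub_eq_add_neg, ← Nat.cast_sub h1, hw _ (by omega), alt_shift φ hφ a q t,
    show (q - t) % 2 = (q + t) % 2 by omega]

/-- **Block doubling.** An alternating block at `n - K ≤ q < n` (`K ≤ n`) becomes, in the `P Pᴴ` reflected word,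
an alternating block at `n - K ≤ q < n + K` (the mirrored letters are `φ`-conjugated AND land at positions of the
opposite parity). -/
theorem block_double (n : ℕ) (φ : γ → γ) (hφ : ∀ a, φ (φ a) = a) (w : ZMod (2 * n) → γ) (a : γ) {K : ℕ}
    (hKn : K ≤ n) (hw : ∀ q : ℕ, n ≤ q + K → q < n → w q = if q % 2 = 0 then a else φ a) :
    ∀ q : ℕ, n ≤ q + K → q < n + K →
      (fun j : ZMod (2 * n) => if j.val < n then w j else φ (w (-1 - j))) q =
        if q % 2 = 0 then a else φ a := by
  intro q h1 h2
  show (if ((q : ℕ) : ZMod (2 * n)).val < n then w q else φ (w (-1 - q))) = _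
  rw [ZMod.val_cast_of_lt (show q < 2 * n by omega)]
  by_cases h : q < n
  · rw [if_pos h]
    exact hw q h1 h
  · rw [if_neg h, neg_one_sub_natCast_eq (by omega : q + 1 ≤ 2 * n), hw (2 * n - 1 - q) (by omega) (by omega)]
    split_ifs <;> first | rfl | exact hφ a | exact (hφ a).symm | omega

/-- Shifting a word with an alternating block at `s ≤ q < s + K` by `s`: an alternating block at `0 ≤ q < K`. -/
theorem block_shift_to_zero (n : ℕ) (φ : γ → γ) (hφ : ∀ a, φ (φ a) = a) (w : ZMod (2 * n) → γ) (a : γ)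
    (s K : ℕ) (hw : ∀ q : ℕ, s ≤ q → q < s + K → w q = if q % 2 = 0 then a else φ a) :
    ∀ q : ℕ, q < K → (fun j : ZMod (2 * n) => w (j + ((s : ℕ) : ZMod (2 * n)))) q =
      if q % 2 = 0 then (if s % 2 = 0 then a else φ a) else φ (if s % 2 = 0 then a else φ a) := by
  intro q hq
  show w (q + ((s : ℕ) : ZMod (2 * n))) = _
  rw [← Nat.cast_add, hw (q + s) (by omega) (by omega), alt_shift φ hφ a q s]

/-- **Saturation.** A word with an alternating block at `0 ≤ q < 2n` is the alternating word. -/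
theorem block_saturate (n : ℕ) [NeZero n] (φ : γ → γ) (w : ZMod (2 * n) → γ) (a : γ)
    (hw : ∀ q : ℕ, q < 2 * n → w q = if q % 2 = 0 then a else φ a) :
    w = fun j : ZMod (2 * n) => if j.val % 2 = 0 then a else φ a := by
  funext j
  have h := hw j.val (ZMod.val_lt j)
  rwa [ZMod.natCast_zmod_val] at h

/-- Rotation invariance under every natural shift, from invariance under the unit shift. -/
theorem shift_invariant_nat (n : ℕ) (Φ : (ZMod (2 * n) → γ) → ℝ)
    (hrot : ∀ w, Φ (fun j => w (j + 1)) = Φ w) (w : ZMod (2 * n) → γ) (t : ℕ) :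
    Φ (fun j => w (j + t)) = Φ w := by
  induction t with
  | zero => simp
  | succ t ih =>
    have hw : (fun j : ZMod (2 * n) => w (j + ((t + 1 : ℕ) : ZMod (2 * n)))) = fun j => w (j + 1 + t) :=
      funext fun j => congrArg w (by push_cast; ring)
    rw [hw, hrot (fun j => w (j + t)), ih]

/-- **An alternating word dominates** (the maximiser argument). For a non-negative functional on the finite word
space `ZMod (2n) → γ` that is rotation invariant and satisfies the reflection step, every word is dominated by some
alternating word `(a, φ a, a, φ a, …)`: a maximiser stays a maximiser under `w ↦ w⁺` and under rotations, and
`O(log n)` block doublings saturate it. -/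
theorem exists_alt_ge [Fintype γ] [DecidableEq γ] (n : ℕ) [NeZero n] (Φ : (ZMod (2 * n) → γ) → ℝ)
    (hΦ : ∀ w, 0 ≤ Φ w) (φ : γ → γ) (hφ : ∀ a, φ (φ a) = a)
    (hrot : ∀ w, Φ (fun j => w (j + 1)) = Φ w)
    (hrefl : ∀ w, Φ w ^ 2 ≤
      Φ (fun j => if j.val < n then w j else φ (w (-1 - j))) *
        Φ (fun j => if j.val < n then φ (w (-1 - j)) else w j))
    (w : ZMod (2 * n) → γ) :
    ∃ a, Φ w ≤ Φ (fun j => if j.val % 2 = 0 then a else φ a) := by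
  classical
  have hn : 0 < n := Nat.pos_of_ne_zero (NeZero.ne n)
  obtain ⟨w₀, -, hw₀⟩ := Finset.exists_max_image Finset.univ Φ ⟨w, Finset.mem_univ _⟩
  set M := Φ w₀ with hM_def
  have hle : ∀ w', Φ w' ≤ M := fun w' => hw₀ w' (Finset.mem_univ _)
  by_cases hM0 : M = 0
  · exact ⟨w 0, (hle _).trans (hM0.le.trans (hΦ _))⟩
  have hMpos : 0 < M := lt_of_le_of_ne (hΦ _) (Ne.symm hM0)
  -- maximality is preserved by the `P Pᴴ` reflection and by shifts
  have hreflMax : ∀ w' : ZMod (2 * n) → γ, Φ w' = M →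
      Φ (fun j => if j.val < n then w' j else φ (w' (-1 - j))) = M := by
    intro w' h
    refine le_antisymm (hle _) ?_
    have h1 := hrefl w'
    rw [h, pow_two] at h1
    exact le_of_mul_le_mul_right (h1.trans (mul_le_mul_of_nonneg_left (hle _) (hΦ _))) hMpos
  have hshiftMax : ∀ (w' : ZMod (2 * n) → γ) (t : ZMod (2 * n)), Φ w' = M →
      Φ (fun j => w' (j + t)) = M := by
    intro w' t h
    rw [← h, ← ZMod.natCast_zmod_val t]
    exact shift_invariant_nat n Φ hrot w' t.val
  -- the doubling chain: maximisers with an alternating block at `0 ≤ q < min (2^r) (2n)`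
  have key : ∀ r : ℕ, ∃ (w' : ZMod (2 * n) → γ) (a : γ), Φ w' = M ∧
      ∀ q : ℕ, q < min (2 ^ r) (2 * n) → w' q = if q % 2 = 0 then a else φ a := by
    intro r
    induction r with
    | zero =>
      refine ⟨w₀, w₀ ((0 : ℕ) : ZMod (2 * n)), hM_def.symm, fun q hq => ?_⟩
      have h1 : min (2 ^ 0) (2 * n) = 1 := by rw [pow_zero]; exact min_eq_left (by omega)
      rw [h1] at hq
      obtain rfl : q = 0 := by omega
      rw [if_pos (Nat.zero_mod 2)]
    | succ r ih =>
      obtain ⟨w', a, hmax, hw'⟩ := ih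
      -- usable block length `K = min (2^r) n ≤ n`; shift it to end at `n - 1`, reflect, shift back
      set K : ℕ := min (2 ^ r) n with hK
      have hKn : K ≤ n := min_le_right _ _
      have hblk : ∀ q : ℕ, q < K → w' q = if q % 2 = 0 then a else φ a :=
        fun q hq => hw' q (lt_min (lt_of_lt_of_le hq (min_le_left _ _)) (by omega))
      set a₁ : γ := if (n - K) % 2 = 0 then a else φ a
      set w₁ : ZMod (2 * n) → γ := fun j => w' (j + -((n - K : ℕ) : ZMod (2 * n)))
      have h1 : ∀ q : ℕ, n ≤ q + K → q < n → w₁ q = if q % 2 = 0 then a₁ else φ a₁ :=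
        fun q hq1 hq2 => block_shift_to_end n φ hφ w' a K (n - K) hblk q (by omega) (by omega)
      set w₂ : ZMod (2 * n) → γ := fun j => if j.val < n then w₁ j else φ (w₁ (-1 - j))
      have h2 : ∀ q : ℕ, n ≤ q + K → q < n + K → w₂ q = if q % 2 = 0 then a₁ else φ a₁ :=
        block_double n φ hφ w₁ a₁ hKn h1
      set a₃ : γ := if (n - K) % 2 = 0 then a₁ else φ a₁
      set w₃ : ZMod (2 * n) → γ := fun j => w₂ (j + ((n - K : ℕ) : ZMod (2 * n)))
      have h3 : ∀ q : ℕ, q < 2 * K → w₃ q = if q % 2 = 0 then a₃ else φ a₃ :=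
        block_shift_to_zero n φ hφ w₂ a₁ (n - K) (2 * K) (fun q hq1 hq2 => h2 q (by omega) (by omega))
      have hmax3 : Φ w₃ = M := hshiftMax w₂ _ (hreflMax w₁ (hshiftMax w' _ hmax))
      refine ⟨w₃, a₃, hmax3, fun q hq => h3 q ?_⟩
      have hq1 := lt_of_lt_of_le hq (min_le_left _ _)
      have hq2 := lt_of_lt_of_le hq (min_le_right _ _)
      rw [pow_succ] at hq1
      omega
  -- saturate
  obtain ⟨w', a, hmax, hw'⟩ := key (2 * n)
  rw [min_eq_right (Nat.lt_two_pow_self (n := 2 * n)).le] at hw'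
  refine ⟨a, ?_⟩
  rw [← block_saturate n φ w' a hw', hmax]
  exact hle w

/-- `∏_j ν(w⁺ j) · ∏_j ν(w⁻ j) = (∏_j ν(w j))²` for a `φ`-invariant weight `ν` (`j ↦ -1 - j` is a bijection). -/
theorem prod_wPlus_mul_prod_wMinus (n : ℕ) [NeZero n] (ν : γ → ℝ) (φ : γ → γ) (hνφ : ∀ a, ν (φ a) = ν a)
    (w : ZMod (2 * n) → γ) :
    (∏ j : ZMod (2 * n), ν (if j.val < n then w j else φ (w (-1 - j)))) *
        (∏ j : ZMod (2 * n), ν (if j.val < n then φ (w (-1 - j)) else w j)) = (∏ j, ν (w j)) ^ 2 := by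
  rw [← prod_mul_distrib]
  have h : ∀ j : ZMod (2 * n), ν (if j.val < n then w j else φ (w (-1 - j))) *
      ν (if j.val < n then φ (w (-1 - j)) else w j) = ν (w j) * ν (w (-1 - j)) := by
    intro j
    split_ifs
    · rw [hνφ]
    · rw [hνφ, mul_comm]
  rw [prod_congr rfl fun j _ => h j, prod_mul_distrib,
    Fintype.prod_equiv (Equiv.subLeft (-1)) (fun j => ν (w (-1 - j))) (fun j => ν (w j)) fun j => rfl, sq]

/-- **Abstract even-cycle chessboard estimate.** A non-negative functional `F` on words `ZMod (2n) → γ` that is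
rotation invariant, satisfies the reflection step `F(w)² ≤ F(w⁺) F(w⁻)` and takes the value `ν a > 0` on the
alternating word `(a, φ a, …)` (`ν` being `φ`-invariant) obeys `F(w)^{2n} ≤ ∏_j ν (w j)`. -/
theorem chessboard_of_reflection [Fintype γ] [DecidableEq γ] (n : ℕ) [NeZero n]
    (F : (ZMod (2 * n) → γ) → ℝ) (hF : ∀ w, 0 ≤ F w) (ν : γ → ℝ) (hν : ∀ a, 0 < ν a)
    (φ : γ → γ) (hφ : ∀ a, φ (φ a) = a) (hνφ : ∀ a, ν (φ a) = ν a)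
    (hrot : ∀ w, F (fun j => w (j + 1)) = F w)
    (hrefl : ∀ w, F w ^ 2 ≤
      F (fun j => if j.val < n then w j else φ (w (-1 - j))) *
        F (fun j => if j.val < n then φ (w (-1 - j)) else w j))
    (halt : ∀ a, F (fun j => if j.val % 2 = 0 then a else φ a) = ν a)
    (w : ZMod (2 * n) → γ) : F w ^ (2 * n) ≤ ∏ j, ν (w j) := by
  have hνprod : ∀ w' : ZMod (2 * n) → γ, 0 < ∏ j, ν (w' j) := fun w' => prod_pos fun j _ => hν _
  -- the normalised functional `Φ(w) = F(w)^{2n} / ∏_j ν(w j)`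
  set Φ : (ZMod (2 * n) → γ) → ℝ := fun w' => F w' ^ (2 * n) / ∏ j, ν (w' j) with hΦ_def
  have hΦnn : ∀ w', 0 ≤ Φ w' := fun w' => div_nonneg (pow_nonneg (hF _) _) (hνprod _).le
  have hΦrot : ∀ w' : ZMod (2 * n) → γ, Φ (fun j => w' (j + 1)) = Φ w' := by
    intro w'
    simp only [hΦ_def]
    rw [hrot w', Fintype.prod_equiv (Equiv.addRight 1) (fun j => ν (w' (j + 1))) (fun j => ν (w' j))
      (fun j => rfl)]
  have hΦrefl : ∀ w' : ZMod (2 * n) → γ, Φ w' ^ 2 ≤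
      Φ (fun j => if j.val < n then w' j else φ (w' (-1 - j))) *
        Φ (fun j => if j.val < n then φ (w' (-1 - j)) else w' j) := by
    intro w'
    simp only [hΦ_def]
    rw [div_pow, div_mul_div_comm, prod_wPlus_mul_prod_wMinus n ν φ hνφ w', ← mul_pow]
    refine div_le_div_of_nonneg_right ?_ (sq_nonneg _)
    calc (F w' ^ (2 * n)) ^ 2 = (F w' ^ 2) ^ (2 * n) := by ring
      _ ≤ _ := pow_le_pow_left₀ (sq_nonneg _) (hrefl w') (2 * n)
  obtain ⟨a, ha⟩ := exists_alt_ge n Φ hΦnn φ hφ hΦrot hΦrefl w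
  have haltΦ : Φ (fun j => if j.val % 2 = 0 then a else φ a) = 1 := by
    simp only [hΦ_def]
    rw [halt a]
    simp only [apply_ite ν, hνφ, ite_self, prod_const, card_univ, ZMod.card]
    exact div_self (pow_ne_zero _ (hν a).ne')
  rw [haltΦ] at ha
  have ha' : F w ^ (2 * n) / ∏ j, ν (w j) ≤ 1 := ha
  rwa [div_le_one (hνprod w)] at ha'

open Matrix
open scoped ComplexOrder

variable {k : Type} [Fintype k] [DecidableEq k]

/-- **The reflection step** for an even word of matrices with `ℕ`-indexed letters, the two reflected words being
described position by position: `‖Tr (X_0 ⋯ X_{2n-1})‖² ≤ ‖Tr (P Pᴴ)‖ · ‖Tr (Qᴴ Q)‖` with `P = X_0 ⋯ X_{n-1}`,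
`Q = X_n ⋯ X_{2n-1}` (Hilbert–Schmidt Cauchy–Schwarz). -/
theorem norm_sq_trace_le_reflect (n : ℕ) (X Xp Xm : ℕ → Matrix k k ℂ)
    (hp : ∀ i < 2 * n, Xp i = if i < n then X i else (X (2 * n - 1 - i))ᴴ)
    (hm : ∀ i < 2 * n, Xm i = if i < n then (X (2 * n - 1 - i))ᴴ else X i) :
    ‖((List.range (2 * n)).map X).prod.trace‖ ^ 2 ≤
      ‖((List.range (2 * n)).map Xp).prod.trace‖ * ‖((List.range (2 * n)).map Xm).prod.trace‖ := by
  have hsplit : ∀ f : ℕ → Matrix k k ℂ, ((List.range (2 * n)).map f).prod =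
      ((List.range n).map f).prod * ((List.range n).map fun t => f (n + t)).prod := by
    intro f
    rw [two_mul, List.range_add, List.map_append, List.prod_append, List.map_map]
    rfl
  obtain ⟨P, hP⟩ : ∃ P : Matrix k k ℂ, ((List.range n).map X).prod = P := ⟨_, rfl⟩
  obtain ⟨Q, hQ⟩ : ∃ Q : Matrix k k ℂ, ((List.range n).map fun t => X (n + t)).prod = Q := ⟨_, rfl⟩
  have hw : ((List.range (2 * n)).map X).prod = P * Q := by rw [hsplit, hP, hQ]
  have hwp : ((List.range (2 * n)).map Xp).prod = P * Pᴴ := by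
    rw [hsplit, ← hP, reflectionStep_conjTranspose_prod_range_map]
    congr 1 <;> refine congrArg List.prod (List.map_congr_left fun i hi => ?_) <;> rw [List.mem_range] at hi
    · rw [hp i (by omega), if_pos hi]
    · rw [hp (n + i) (by omega), if_neg (by omega), show 2 * n - 1 - (n + i) = n - 1 - i by omega]
  have hwm : ((List.range (2 * n)).map Xm).prod = Qᴴ * Q := by
    rw [hsplit, ← hQ, reflectionStep_conjTranspose_prod_range_map]
    congr 1 <;> refine congrArg List.prod (List.map_congr_left fun i hi => ?_) <;> rw [List.mem_range] at hi
    · rw [hm i (by omega), if_pos hi, show n + (n - 1 - i) = 2 * n - 1 - i by omega]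
    · rw [hm (n + i) (by omega), if_neg (by omega)]
  rw [hw, hwp, hwm]
  calc ‖(P * Q).trace‖ ^ 2 ≤ (P * Pᴴ).trace.re * (Qᴴ * Q).trace.re := reflectionStep_norm_sq_trace_mul_le P Q
    _ ≤ _ := mul_le_mul ((le_abs_self _).trans (Complex.abs_re_le_norm _))
        ((le_abs_self _).trans (Complex.abs_re_le_norm _))
        (Complex.nonneg_iff.mp (posSemidef_conjTranspose_mul_self Q).trace_nonneg).1 (norm_nonneg _)

/-- The alternating word `X, Xᴴ, X, Xᴴ, …` of length `2m` multiplies to `(X Xᴴ)^m`. -/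
theorem prod_map_range_alt (X : Matrix k k ℂ) (m : ℕ) :
    ((List.range (2 * m)).map fun i : ℕ => if i % 2 = 0 then X else Xᴴ).prod = (X * Xᴴ) ^ m := by
  induction m with
  | zero => simp
  | succ m ih =>
    rw [show 2 * (m + 1) = 2 * m + 1 + 1 by ring, List.prod_range_succ, List.prod_range_succ, ih,
      if_pos (by omega : 2 * m % 2 = 0), if_neg (by omega : ¬(2 * m + 1) % 2 = 0), pow_succ,
      Matrix.mul_assoc]

/-- `Tr ((A B)^m) = Tr ((B A)^m)`. -/
theorem trace_pow_mul_comm (A B : Matrix k k ℂ) : ∀ m : ℕ, ((A * B) ^ m).trace = ((B * A) ^ m).trace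
  | 0 => by simp
  | m + 1 => by rw [pow_succ, ← Matrix.mul_assoc, mul_pow_mul, trace_mul_cycle, pow_succ']

/-- A Hermitian matrix with a vanishing power vanishes. -/
theorem eq_zero_of_conjTranspose_eq_of_pow_eq_zero {A : Matrix k k ℂ} (hA : Aᴴ = A) :
    ∀ m : ℕ, A ^ (m + 1) = 0 → A = 0 := by
  intro m
  induction m using Nat.strong_induction_on with
  | _ m ih =>
    intro h
    rcases Nat.eq_zero_or_pos m with rfl | hm
    · rwa [zero_add, pow_one] at h
    · have h2 : (A ^ (m / 2 + 1))ᴴ * A ^ (m / 2 + 1) = 0 := by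
        rw [conjTranspose_pow, hA, ← pow_add,
          show m / 2 + 1 + (m / 2 + 1) = (m + 1) + (2 * (m / 2) + 1 - m) by omega, pow_add, h,
          Matrix.zero_mul]
      exact ih (m / 2) (by omega) (conjTranspose_mul_self_eq_zero.mp h2)

/-- `Re Tr ((B Bᴴ)^n) > 0` for `B ≠ 0` and `n ≥ 1`
(`Tr ((B Bᴴ)^n) = 0 ⇒ (B Bᴴ)^n = 0 ⇒ B Bᴴ = 0 ⇒ B = 0`). -/
theorem trace_pow_self_mul_conjTranspose_re_pos {B : Matrix k k ℂ} (hB : B ≠ 0) (n : ℕ) [NeZero n] :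
    0 < ((B * Bᴴ) ^ n).trace.re := by
  have hpsd := (posSemidef_self_mul_conjTranspose B).pow n
  have h := Complex.nonneg_iff.mp hpsd.trace_nonneg
  refine lt_of_le_of_ne h.1 fun h0 => hB ?_
  have htr : ((B * Bᴴ) ^ n).trace = 0 :=
    Complex.ext (by simpa using h0.symm) (by simpa using h.2.symm)
  rw [hpsd.trace_eq_zero_iff] at htr
  obtain ⟨m, rfl⟩ := Nat.exists_eq_succ_of_ne_zero (NeZero.ne n)
  exact self_mul_conjTranspose_eq_zero.mp (eq_zero_of_conjTranspose_eq_of_pow_eq_zero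
    (by rw [conjTranspose_mul, conjTranspose_conjTranspose]) m htr)

end EvenCycleChessboard

open Matrix EvenCycleChessboard in
open scoped ComplexOrder in
open Summit.QuantumFields.QCD.Cruxes.WilsonQuarkStability.FreeTangentLandauChessboard.ChessboardOfReflection
  Summit.QuantumFields.QCD.Cruxes.WilsonQuarkStability.FreeTangentLandauChessboard.CyclicHolder in
/-- **Helper stub `evenCycleChessboard`** (Route B, step B4, of `stub_heavyFrequencyGain`; line `Sketch`,
crux stmt-QuantumFields-9734): the even-cycle chessboard estimate = generalised Hölder inequality for Schatten
norms with `2n` equal exponents, `‖Tr (B_0 ⋯ B_{2n-1})‖^{2n} ≤ ∏_j Re Tr ((B_j B_jᴴ)^n)` (module docstring). -/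
theorem evenCycleChessboard : ∀ {k : Type} [Fintype k] [DecidableEq k] (n : ℕ), 0 < n →
    ∀ (B : Fin (2 * n) → Matrix k k ℂ),
    ‖(List.ofFn B).prod.trace‖ ^ (2 * n) ≤ ∏ j : Fin (2 * n), ((B j * (B j)ᴴ) ^ n).trace.re := by
  intro k _ _ n hn B
  haveI : NeZero n := ⟨hn.ne'⟩
  -- degenerate letters: a vanishing `B j` kills the left-hand side
  by_cases hB0 : ∃ j, B j = 0
  · obtain ⟨j, hj⟩ := hB0
    rw [List.prod_eq_zero (List.mem_ofFn.2 ⟨j, hj⟩), trace_zero, norm_zero, zero_pow (by omega)]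
    exact Finset.prod_nonneg fun j _ =>
      (Complex.nonneg_iff.mp ((posSemidef_self_mul_conjTranspose (B j)).pow n).trace_nonneg).1
  push Not at hB0
  -- `ℕ`-indexed letters, the alphabet `ZMod (2n) × Bool`, the weights `ν` and the word functional `F`
  set B' : ℕ → Matrix k k ℂ := fun q => if h : q < 2 * n then B ⟨q, h⟩ else 0 with hB'
  have hB'q : ∀ (q : ℕ) (hq : q < 2 * n), B' q = B ⟨q, hq⟩ := fun q hq => by simp only [hB', dif_pos hq]
  set L : ZMod (2 * n) × Bool → Matrix k k ℂ := fun c => bif c.2 then (B' c.1.val)ᴴ else B' c.1.val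
  set φ : ZMod (2 * n) × Bool → ZMod (2 * n) × Bool := fun c => (c.1, !c.2) with hφ_def
  set ν : ZMod (2 * n) × Bool → ℝ := fun c => ((B' c.1.val * (B' c.1.val)ᴴ) ^ n).trace.re
  set F : (ZMod (2 * n) → ZMod (2 * n) × Bool) → ℝ := fun w =>
    ‖((List.range (2 * n)).map fun i : ℕ => L (w (i : ZMod (2 * n)))).prod.trace‖
  have hφ : ∀ c, φ (φ c) = c := fun c => by simp [hφ_def]
  have hLφ : ∀ c, L (φ c) = (L c)ᴴ := by
    rintro ⟨j, _ | _⟩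
    · rfl
    · exact (conjTranspose_conjTranspose _).symm
  have hν : ∀ c, 0 < ν c := fun c => by
    show 0 < ((B' c.1.val * (B' c.1.val)ᴴ) ^ n).trace.re
    rw [hB'q c.1.val (ZMod.val_lt c.1)]
    exact trace_pow_self_mul_conjTranspose_re_pos (hB0 _) n
  have hval : ∀ i : ℕ, i < 2 * n → ((i : ℕ) : ZMod (2 * n)).val = i := fun i hi => ZMod.val_cast_of_lt hi
  have hrot : ∀ w, F (fun j => w (j + 1)) = F w := fun w =>
    congrArg norm (trace_prod_map_range_succ (fun j => L (w j)))
  have hrefl : ∀ w : ZMod (2 * n) → ZMod (2 * n) × Bool, F w ^ 2 ≤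
      F (fun j => if j.val < n then w j else φ (w (-1 - j))) *
        F (fun j => if j.val < n then φ (w (-1 - j)) else w j) := by
    intro w
    refine norm_sq_trace_le_reflect n (fun i : ℕ => L (w i)) _ _ (fun i hi => ?_) (fun i hi => ?_) <;>
    · show L (if ((i : ℕ) : ZMod (2 * n)).val < n then _ else _) = _
      rw [hval i hi, apply_ite L, hLφ, neg_one_sub_natCast_eq (by omega : i + 1 ≤ 2 * n)]
  have halt : ∀ c, F (fun j => if j.val % 2 = 0 then c else φ c) = ν c := by
    rintro ⟨j, b⟩
    have hlist : ((List.range (2 * n)).map fun i : ℕ =>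
        L (if ((i : ℕ) : ZMod (2 * n)).val % 2 = 0 then (j, b) else φ (j, b))) =
        (List.range (2 * n)).map fun i : ℕ => if i % 2 = 0 then L (j, b) else (L (j, b))ᴴ := by
      refine List.map_congr_left fun i hi => ?_
      rw [List.mem_range] at hi
      rw [hval i hi, apply_ite L, hLφ]
    show ‖((List.range (2 * n)).map fun i : ℕ =>
        L (if ((i : ℕ) : ZMod (2 * n)).val % 2 = 0 then (j, b) else φ (j, b))).prod.trace‖ = ν (j, b)
    rw [hlist, prod_map_range_alt,
      norm_trace_eq_re_of_posSemidef ((posSemidef_self_mul_conjTranspose (L (j, b))).pow n)]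
    cases b
    · rfl
    · show (((B' j.val)ᴴ * (B' j.val)ᴴᴴ) ^ n).trace.re = ((B' j.val * (B' j.val)ᴴ) ^ n).trace.re
      rw [conjTranspose_conjTranspose, trace_pow_mul_comm]
  -- the abstract chessboard estimate for the word `(0, ff), (1, ff), …, (2n-1, ff)`; identify both sides
  have key := chessboard_of_reflection n F (fun w => norm_nonneg _) ν hν φ hφ (fun c => rfl) hrot hrefl halt
    (fun j => (j, false))
  have hlist : List.ofFn B = (List.range (2 * n)).map fun i : ℕ => L ((i : ZMod (2 * n)), false) := by
    rw [List.ofFn_eq_map, ← List.map_coe_finRange_eq_range, List.map_map]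
    refine List.map_congr_left fun i _ => ?_
    show B i = bif false then (B' (((i : ℕ) : ZMod (2 * n)).val))ᴴ else B' (((i : ℕ) : ZMod (2 * n)).val)
    rw [Bool.cond_false, hval i.val i.isLt, hB'q i.val i.isLt]
  have hprod : ∏ j : ZMod (2 * n), ν (j, false) = ∏ j : Fin (2 * n), ((B j * (B j)ᴴ) ^ n).trace.re := by
    rw [prod_univ_eq_prod_range (fun j : ZMod (2 * n) => ν (j, false)),
      ← Fin.prod_univ_eq_prod_range (fun q : ℕ => ν ((q : ZMod (2 * n)), false)) (2 * n)]
    refine Finset.prod_congr rfl fun i _ => ?_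
    show ((B' (((i : ℕ) : ZMod (2 * n)).val) * (B' (((i : ℕ) : ZMod (2 * n)).val))ᴴ) ^ n).trace.re = _
    rw [hval i.val i.isLt, hB'q i.val i.isLt]
  rw [hlist, ← hprod]
  exact key

end Summit.QuantumFields.QCD.Cruxes.CriticalLineDiamagnetism.ChessboardCellGain
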